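/-
Copyright (c) 2026. All rights reserved.
Released under Apache 2.0 license as described in the file LICENSE.
Authors: abc-iut cell, F-wave prover seat abc-iut-f-101 (gen 4), over abc-iut-w5-d053's open-augmentation sub-model
(`LogFrobeniusMonoGenuineProp58viiPfOpen.lean`), abc-iut-w4-d095's perfected genuine containers
(`LogFrobeniusMonoGenuineProp58viiPf.lean`), abc-iut-L4-t3's add-ons and this seat's `η⊢`-components (parts 1–2) and
pinned Cor 5.10 (iv)(b)(c) assembly (`LogFrobeniusMonoTelecoreContact.lean`).
-/
import Literature.AnabelianGeometry.AbsoluteAnabelian.LogFrobeniusMonoEtaNaturality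
import Literature.AnabelianGeometry.AbsoluteAnabelian.LogFrobeniusMonoGenuineProp58viiPfOpen
import Literature.AnabelianGeometry.AbsoluteAnabelian.LogFrobeniusMonoTelecoreContact
import HarnessLib

/-!
# [AbsTopIII] Cor 5.10 (iv)(b)(c) HOLDS — in its print-faithful PINNED reading — at the GENUINE nonarchimedean
# mono-analytic model on the open-augmentation sub-model: the (d)-datum `η⊢_{v,ν}`, its coherence, the telecore

S. Mochizuki, *Topics in absolute anabelian geometry III: global reconstruction algorithms*, J. Math. Sci. Univ.
Tokyo 22 (2015) 939–1156 [MochizukiAbsTopIII2015]; locators = pages of the author's manuscript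
(`paper:url-5493eb38cbb7`), read on the page: Cor 5.10 (iv)(b)(c) pp. 147–148 (the mono-analytic telecore `𝔗_{An⊢}`, the
contact structure `ℋ_{An⊢}`, "isomorphisms `η⊢_{v,ν}` … between the composites
`□ → 𝒩⊞_v → 𝒩_v → ℰ• → ℰ⊢ → An⊢ → 𝒩⊢⊞_v` and `□ → 𝒩⊞_v → 𝒩⊢⊞_v`"), Def 5.6 (iii)/(iv) pp. 135–136 (mono-analyticization
homotopies), Prop 5.8 (vii) pp. 141–142 (`ψ^{An⊢⊞}_{w,ν}` over `ℰ⊢`), Def 3.1 (i)/(ii) pp. 66–67 (`Π_k ↠ G_k`).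

## What this file builds (node [AbsTopIII] Cor 5.10 (iv), layer L4; L4-lead m88/m99/m104 row «MTC-GENUINE-POSITIVE», part 3)

At the §5 setting `L := nonarchGenuineMonoAnPfOpen p Vmod (fun _ => false)` — abc-iut-w4-d095's genuine nonarchimedean rows
and GENUINE Prop 5.8 (vii) mono-analytic rows with the perfected containers, restricted by abc-iut-w5-d053 to the full
subcategory `𝒳^{open}` of holomorphic model objects with OPEN augmentation `ε_k` (every profinite `Π_X` qualifies), over
an index set of NONARCHIMEDEAN places (the archimedean rows of all these settings are placeholders; the arc lane is
abc-iut-w6-d025's):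

* `anMonoEquiv_unitIso_hom_app` / `_inv_app` — the unit of abc-iut-w6-d036's `Th⊢ ≌ An⊢` has identity components;
* `etaComp`, `etaComp_naturality` — the four `𝒞_TS`-components of parts 1–2 dispatched on the cross vertices of `Γ⃗×_non`;
* ★ `etaOpen v ν hν` — **the printed NATURAL isomorphism `η⊢_{v,ν}`** between the two composite functors of Cor 5.10 (iv)(c)
  at `L`, identity on the base `ℰ⊢`, `(Π_k/Ker ≃ₜ* G_k)⁻¹` on Galois groups, and on arithmetic data: the identity of
  `𝒪^×_{ℚ̄_p}` / of `ℚ̄_p^×`, the GENUINE logarithm `log_k̄ : 𝒪^× ⧸ μ ⥲ k̄`, the identity of `ℚ̄_p^× ⧸ μ`;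
* `monoAnalyticizationHomotopies_open`, ★ `monoTelecoreCoherence_open` — abc-iut-L4-t3's add-ons (a)+(b) and (c)+(d)+coherence
  INHABITED at `L` (the coherence "`η⊢` lies over `ℰ⊢`" holds because every leg over the base is an identity);
* ★ **`cor510MonoTelecorePinned_genuineOpen`** — `L.Cor510MonoTelecorePinned` for every `V(F_mod) ≠ ∅`: the PRINT-FAITHFUL
  pinned Cor 5.10 (iv)(b)(c) (abc-iut-L4-t3's successor statement of FACT-LIST F-0139) HOLDS AT A GENUINE CARRIER, by this
  seat's sufficiency theorem `cor510MonoTelecorePinned_of` (p463433); and `cor510MonoTelecorePinned_genuineOpen_iff`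
  (`↔ Nonempty Vmod`, this seat's p465762).

CONTRAST (honest): at the unrestricted settings `nonarchGenuineMonoAn(Pf)` (`𝒳 = TFModel p`, `ε_k` merely a continuous
surjection) the add-on is EMPTY (abc-iut-f-101 2026-08-26, certificate by abc-iut-w5-d053): the restriction to open
augmentations is exactly what print's profinite `Π_X` supplies.  HONEST FRAMING: MODEL-LEVEL (one nonarchimedean place type,
discrete arithmetic data per Rmk 3.1.1, torsion-quotient perfections, `An• := 𝒳` placeholder as in all these settings);
classical local class field theory and the `p`-adic logarithm as proved in the tree; refereed pre-IUT material; nothing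
here bears on [IUTchIII] Cor. 3.12; no side taken; instantiated ≠ endorsed; typed ≠ proved.
-/

set_option autoImplicit false

noncomputable section

namespace Literature.AnabelianGeometry.AbsoluteAnabelian

open CategoryTheory Topology
open scoped nonZeroDivisors

/-! ## Part 1. The unit of `Th⊢ ≌ An⊢` has identity components -/

namespace MLFClosure

/-- The unit of abc-iut-w6-d036's equivalence `anMonoEquiv : MonoBase ≌ AnMono` (built by `Equivalence.mk`, hence
adjointified) has identity components: read off the triangle law against the identity counit, the functor being faithful.
[cite: MochizukiAbsTopIII2015, Prop 5.8 (vii) p.141] -/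
theorem anMonoEquiv_unitIso_hom_app (C : MonoBase) : anMonoEquiv.unitIso.hom.app C = 𝟙 C := by
  -- triangle law `F(η_C) ≫ ε_{F C} = 𝟙`, with `ε_{F C} = 𝟙` on the nose, and `F` faithful
  have h1 : anMonoEquiv.functor.map (anMonoEquiv.unitIso.hom.app C) = 𝟙 _ :=
    (Category.comp_id _).symm.trans (anMonoEquiv.functor_unitIso_comp C)
  exact anMonoEquiv.functor.map_injective (h1.trans (anMonoEquiv.functor.map_id _).symm)

/-- Hence the inverse unit has identity components too. [cite: MochizukiAbsTopIII2015, Prop 5.8 (vii) p.141] -/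
theorem anMonoEquiv_unitIso_inv_app (C : MonoBase) : anMonoEquiv.unitIso.inv.app C = 𝟙 C :=
  (anMonoEquiv.unitIso.app C).inv_ext
    ((Category.comp_id _).trans (anMonoEquiv_unitIso_hom_app C))

end MLFClosure

namespace LogFrobeniusSetting

open AbsTopIII

variable (p : ℕ) [Fact p.Prime]

/-! ## Part 2. The components on the cross vertices of `Γ⃗×_non` and their naturality -/

/-- **The component of `η⊢_{v,ν}` at an object of `𝒳^{open}`**, dispatched on `ν ∈ Γ⃗×_non = {𝒪^×, k̄^×, k~, (k̄^×)^pf}`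
(parts 1–2: `etaUnitsIso`, `etaTimesIso`, `etaShellIso`, `etaPerfIso`); the post-log and space-link vertices are not in
`Γ⃗×_v`. [cite: MochizukiAbsTopIII2015, Cor 5.10 (iv)(c) p. 148] -/
def etaComp : (ν : LogVertex false) → ν.IsCross → (A : TFModelOpen p) →
    ((MLFClosure.monoContainerPf false ν).obj (TFModel.closureObj A.obj) ≅ TSObj.monoAn.obj ((nonarchLoc p ν).obj A.obj))
  | NonarchVertex.units, _, A => A.obj.etaUnitsIso A.property
  | NonarchVertex.mult, _, A => A.obj.etaTimesIso A.property
  | NonarchVertex.shellCod, _, A => A.obj.etaShellIso A.property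
  | NonarchVertex.perf, _, A => A.obj.etaPerfIso A.property
  | NonarchVertex.postLog, h, _ => absurd h.1 (by decide)
  | NonarchVertex.spaceLink, h, _ => absurd h.2 (by decide)

/-- Naturality of the components in morphisms of `𝒳^{open}` (part 2's four squares).
[cite: MochizukiAbsTopIII2015, Cor 5.10 (iv)(c) p. 148] -/
theorem etaComp_naturality : ∀ (ν : LogVertex false) (hν : ν.IsCross) {A B : TFModelOpen p} (g : A ⟶ B),
    (MLFClosure.monoContainerPf false ν).map (TFModel.closureMap ((TFModelOpen.ι p).map g)) ≫
        (etaComp p ν hν B).hom =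
      (etaComp p ν hν A).hom ≫ TSObj.monoAn.map ((nonarchLoc p ν).map ((TFModelOpen.ι p).map g))
  | NonarchVertex.units, _, A, B, g => TFModel.etaUnitsIso_naturality A.property B.property _
  | NonarchVertex.mult, _, A, B, g => TFModel.etaTimesIso_naturality A.property B.property _
  | NonarchVertex.shellCod, _, A, B, g => TFModel.etaShellIso_naturality A.property B.property _
  | NonarchVertex.perf, _, A, B, g => TFModel.etaPerfIso_naturality A.property B.property _
  | NonarchVertex.postLog, h, _, _, _ => absurd h.1 (by decide)
  | NonarchVertex.spaceLink, h, _, _, _ => absurd h.2 (by decide)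

/-! ## Part 3. The printed natural isomorphisms `η⊢_{v,ν}` at the open-augmentation setting -/

variable (Vmod : Type 1)

/-- The setting of this file: genuine nonarchimedean + genuine perfected mono-analytic rows on `𝒳^{open}`, all places
nonarchimedean. [cite: MochizukiAbsTopIII2015, Prop 5.8 (vii) p.141] -/
abbrev genuineOpen : LogFrobeniusSetting Vmod (fun _ => false) := nonarchGenuineMonoAnPfOpen p Vmod (fun _ => false)

/-- ★ **`η⊢_{v,ν}`** (Cor 5.10 (iv)(c)): the natural isomorphism between the functors of
`γ¹_{v,ν} = □ →(λ⊞_{v,ν}) 𝒩⊞_v → 𝒩_v → ℰ• → ℰ⊢ ⥲ An⊢[𝒩⊢⊞] →(ψ^{An⊢⊞}_{v,ν}) 𝒩⊢⊞_v` and of `γ⁰_{v,ν} = □ → 𝒩⊞_v → 𝒩⊢⊞_v` at the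
genuine open-augmentation setting: componentwise the identity of the base point `G_k ∈ ℰ⊢` paired with the `𝒞_TS`-isomorphism
`(G_k ↷ M_ν(G_k)) ≅ (Π_k/Ker ε_k ↷ M_ν)` of parts 1–2. [cite: MochizukiAbsTopIII2015, Cor 5.10 (iv)(c) p. 148] -/
def etaOpen (v : Vmod) (ν : LogVertex false) (hν : ν.IsCross) :
    (genuineOpen p Vmod).lam v ν ⋙ (genuineOpen p Vmod).forget v ⋙ (genuineOpen p Vmod).toE v ⋙
        (genuineOpen p Vmod).monoAn ⋙ (genuineOpen p Vmod).κAnMono.functor ⋙ (genuineOpen p Vmod).ψAnMono v ⟨ν, hν⟩ ≅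
      (genuineOpen p Vmod).lam v ν ⋙ (genuineOpen p Vmod).monoNplus v :=
  NatIso.ofComponents
    (fun X => InducedCategory.isoMk (Iso.prod (Iso.refl (TFModel.closureObj X.down.obj)) (etaComp p ν hν X.down)))
    (fun f => InducedCategory.hom_ext (Prod.ext
      ((Category.comp_id _).trans (Category.id_comp _).symm)
      (etaComp_naturality p ν hν f.hom)))

/-- `η⊢_{v,ν}` lies over the base point ON THE NOSE: its image in `ℰ⊢` is the identity.
[cite: MochizukiAbsTopIII2015, Cor 5.10 (iv)(c) p. 148] -/
theorem toEmono_map_etaOpen_app (v : Vmod) (ν : LogVertex false) (hν : ν.IsCross) (y : (genuineOpen p Vmod).X) :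
    ((genuineOpen p Vmod).toEmono v).map (((genuineOpen p Vmod).forgetMono v).map ((etaOpen p Vmod v ν hν).hom.app y)) =
      𝟙 _ := rfl

/-! ## Part 4. The add-ons inhabited and the pinned Cor 5.10 (iv)(b)(c) at a genuine carrier -/

/-- (a)+(b): the mono-analyticization homotopies with the rows-4→5 square commuting ON THE NOSE (identity) and abc-iut-w5-d053's
rows-6→7 homotopy. [cite: MochizukiAbsTopIII2015, Cor 5.10 (iv) p. 146] -/
def monoAnalyticizationHomotopies_open : (genuineOpen p Vmod).MonoAnalyticizationHomotopies where
  toE _ := Iso.refl _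
  anToE := (nonarchGenuineMonoAnPfOpen_monoAnalyticizationHomotopies p Vmod (fun _ => false)).anToE

/-- The coherence «`η⊢_{v,ν}` lies over `ℰ⊢`» at the genuine open-augmentation setting: every leg over the base is an
identity (the `η`-image by `toEmono_map_etaOpen_app`, the rows-3→4 and 4→5 homotopies, "`ψ` over `ℰ⊢`", and the unit of
`Th⊢ ≌ An⊢` by `anMonoEquiv_unitIso_inv_app`). [cite: MochizukiAbsTopIII2015, Cor 5.10 (iv)(c) p. 148] -/
theorem etaOpen_over (v : Vmod) (ν : LogVertex false) (hν : ν.IsCross) (y : (genuineOpen p Vmod).X) :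
    ((genuineOpen p Vmod).toEmono v).map (((genuineOpen p Vmod).forgetMono v).map ((etaOpen p Vmod v ν hν).hom.app y)) ≫
        ((genuineOpen p Vmod).toEmono v).map (((genuineOpen p Vmod).monoHomotopy v).hom.app
          (((genuineOpen p Vmod).lam v ν).obj y)) ≫
          ((monoAnalyticizationHomotopies_open p Vmod).toE v).hom.app
            (((genuineOpen p Vmod).forget v).obj (((genuineOpen p Vmod).lam v ν).obj y)) =
      (nonarchGenuineMonoAnPfOpen_ψOverIso p Vmod (fun _ => false) v ⟨ν, hν⟩).hom.app
          (((genuineOpen p Vmod).lam v ν ⋙ (genuineOpen p Vmod).forget v ⋙ (genuineOpen p Vmod).toE v ⋙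
            (genuineOpen p Vmod).monoAn ⋙ (genuineOpen p Vmod).κAnMono.functor).obj y) ≫
        (genuineOpen p Vmod).κAnMono.unitIso.inv.app
          (((genuineOpen p Vmod).lam v ν ⋙ (genuineOpen p Vmod).forget v ⋙ (genuineOpen p Vmod).toE v ⋙
            (genuineOpen p Vmod).monoAn).obj y) := by
  -- every leg is an identity of `ℰ⊢ = Up MonoBase`; the unit of `Th⊢ ≌ An⊢` by `anMonoEquiv_unitIso_inv_app`
  apply InducedCategory.hom_ext
  change 𝟙 (TFModel.closureObj y.down.obj) ≫ 𝟙 _ ≫ 𝟙 _ =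
    𝟙 (TFModel.closureObj y.down.obj) ≫ MLFClosure.anMonoEquiv.unitIso.inv.app (TFModel.closureObj y.down.obj)
  rw [MLFClosure.anMonoEquiv_unitIso_inv_app]
  simp

/-- ★ (c)+(d)+coherence: **abc-iut-L4-t3's add-on `MonoTelecoreCoherence` INHABITED at the genuine open-augmentation setting**
— `psiOver` on the nose (abc-iut-w5-d053 / abc-iut-w4-d095), `eta := etaOpen` (the genuine `η⊢_{v,ν}`), `eta_over` by
`etaOpen_over`. [cite: MochizukiAbsTopIII2015, Cor 5.10 (iv)(c) p. 148] -/
def monoTelecoreCoherence_open :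
    (genuineOpen p Vmod).MonoTelecoreCoherence (monoAnalyticizationHomotopies_open p Vmod) where
  psiOver w j := nonarchGenuineMonoAnPfOpen_ψOverIso p Vmod (fun _ => false) w j
  eta v ν hν := etaOpen p Vmod v ν hν
  eta_over v ν hν y := etaOpen_over p Vmod v ν hν y

/-- ★★ **[AbsTopIII] Cor 5.10 (iv)(b)(c), print-faithful PINNED reading, HOLDS AT A GENUINE CARRIER**: for every index set
`V(F_mod) ≠ ∅` of nonarchimedean places, the §5 setting with genuine nonarchimedean rows, genuine perfected mono-analytic
containers (Prop 5.8 (ii)/(vii) by local class field theory) on the open-augmentation sub-model satisfies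
`Cor510MonoTelecorePinned` — the mono-analytic telecore `𝔗_{An⊢}` and a contact structure `ℋ_{An⊢}` containing the pinned
pairs `(γ¹_{v,ν}, γ⁰_{v,ν})` EXIST there (this seat's sufficiency theorem `cor510MonoTelecorePinned_of`, p463433, fed with the
genuine `η⊢`). [cite: MochizukiAbsTopIII2015, Cor 5.10 (iv)(b)(c) pp. 147–148] -/
theorem cor510MonoTelecorePinned_genuineOpen [Nonempty Vmod] : (genuineOpen p Vmod).Cor510MonoTelecorePinned :=
  (monoTelecoreCoherence_open p Vmod).cor510MonoTelecorePinned

/-- The same with the four binders fed directly (no structure): `hN`, `hψ` identities, `hη := etaOpen`, `hcoh := etaOpen_over`.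
[cite: MochizukiAbsTopIII2015, Cor 5.10 (iv)(b)(c) pp. 147–148] -/
theorem cor510MonoTelecorePinned_genuineOpen' [Nonempty Vmod] : (genuineOpen p Vmod).Cor510MonoTelecorePinned :=
  (genuineOpen p Vmod).cor510MonoTelecorePinned_of (fun _ => Iso.refl _)
    (fun w j => nonarchGenuineMonoAnPfOpen_ψOverIso p Vmod (fun _ => false) w j) (etaOpen p Vmod)
    (etaOpen_over p Vmod)

/-- **The pinned Cor 5.10 (iv)(b)(c) at the genuine open-augmentation setting, EXACTLY**: it holds iff `V(F_mod) ≠ ∅` (this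
seat's `MonoTelecoreCoherence.cor510MonoTelecorePinned_iff`, p465762, at the genuine add-on).
[cite: MochizukiAbsTopIII2015, Cor 5.10 (iv)(b)(c) pp. 147–148] -/
theorem cor510MonoTelecorePinned_genuineOpen_iff :
    (genuineOpen p Vmod).Cor510MonoTelecorePinned ↔ Nonempty Vmod :=
  (monoTelecoreCoherence_open p Vmod).cor510MonoTelecorePinned_iff

/-- Bookkeeping form for the FACT-LIST / LF-ABSTOP row F-0139 («NO positive genuine instance yet» — now there is one): a
§5 setting with genuine nonarchimedean and genuine mono-analytic rows whose `𝒳` consists of open-augmentation objects ONLY,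
carrying the add-ons (a)(b) and (c)(d)+coherence, at which Cor 5.10 (iv)(a) AND the pinned (iv)(b)(c) hold.
[cite: MochizukiAbsTopIII2015, Cor 5.10 (iv) pp. 146–148] -/
theorem exists_genuine_cor510MonoTelecorePinned [Nonempty Vmod] :
    ∃ (L : LogFrobeniusSetting Vmod (fun _ => false)) (M : L.MonoAnalyticizationHomotopies),
      Nonempty (L.MonoTelecoreCoherence M) ∧ L.X = Up (TFModelOpen p) ∧ L.Cor510MonoCores ∧ L.Cor510MonoTelecorePinned :=
  ⟨genuineOpen p Vmod, monoAnalyticizationHomotopies_open p Vmod, ⟨monoTelecoreCoherence_open p Vmod⟩, rfl,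
    nonarchGenuineMonoAnPfOpen_cor510MonoCores p Vmod (fun _ => false), cor510MonoTelecorePinned_genuineOpen p Vmod⟩

end LogFrobeniusSetting

end Literature.AnabelianGeometry.AbsoluteAnabelian

end
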